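import Literature.NumberTheory.LFunctions.Polymath15RtNBound
import HarnessLib

/-!
# Polymath 15, Proposition 6.6 (vi) with the corrected `ε̃♯`: `e♯_{C,0} ≤ errC0`

Topic `Literature/NumberTheory/LFunctions` — companion of `Polymath15RtNBound.lean` (Prop. 6.3 with
the corrected majorant `ε̃♯ = epsSharp`, item E3♯) and `Polymath15ErrorMajorants.lean` (Prop. 6.6
(iv)–(vi) as printed, item E4a, in particular `Q_le`). This file is item **E4a♯** of the typed
decomposition of the printed proof of Polymath 15, Thm. 1.3: in the region (1.6)
(`EffRegion t x y`: `0 < t ≤ 1/2`, `0 ≤ y ≤ 1`, `x ≥ 200`) the corrected error term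

  `e♯_{C,0} := e^{tπ²/64} |M₀(iT')| (1 + ε̃♯(s₋) + ε̃♯(s₊)) / |B_t(x+iy)|`, `T' = x/2 + πt/8`,

with `ε̃♯(s_∓) = epsSharp t ((1∓y)/2) (x/2)`, is still dominated by the printed majorant `errC0` of
Thm. 1.3 (`Literature.NumberTheory.LFunctions.Polymath15.eC0Sharp_le_errC0`). As in the source the
proof is `Q_le` (the factor `e^{tπ²/64}|M₀(iT')|/|M_t(s₊)|`), `1 + u ≤ e^u`, `N ≤ a` and
`1/(x − 8.52) ≤ 1/(x−12)`; the new content is the elementary inequality (`cQ_add_epsSharp_le`)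

  `L/(2x²) + 3.58/(x−6) + ε̃♯(s₋) + ε̃♯(s₊) ≤ 1.24 (3^y + 3^{−y})/a + (3L + 10.44)/x`,
  `L = log(x/4π)`, `a = √(x/4π + t/16)`,

obtained by flattening the Gaussian factors of `ε̃♯` (`gaussF_le`: `F(t,σ,κ,c) ≤ e^{cσ+tc²/4}
e^{3.21κ}`; `gaussF_tauS_le` for the `2^{−u}` family on the half line), and two budgets with
explicit decimal constants: the `1/a` terms (`budget_I`: `0.1995·e^{t log²3}(9^{σ₋}+9^{σ₊}) =
0.5985 e^{t log²3}(3^y+3^{−y}) ≤ 1.0953 (3^y+3^{−y})`, the `2^{−u}` family `≤ 0.1775·1.3715`,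
against `1.24(3^y+3^{−y})`, using `3^y + 3^{−y} ≥ 2`) and the `1/x` terms (`budget_II`: against
`(3L + 10.44)/x` using `L ≥ 2.7`). Numerically the slack is ≥ 5 % of the exponent throughout (1.6)
(not part of the proofs). No new named fact is introduced; `arias_lehmer_rs_bound` enters only E3♯.

## Contents

* `gaussF_le`, `bFlat`, `gaussF_tauS_le`, `omegaS`, `epsSharp_le` — flattening `ε̃♯`;
* `cQ_add_epsSharp_le`, `exp_mul_one_add_epsSharp_le` — the inequality against the exponent of `errC0`;
* `eC0Sharp`, `eC0Sharp_le_errC0` — E4a♯.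

## References

* D. H. J. Polymath, *Effective approximation of heat flow evolution of the Riemann ξ function, and
  a new upper bound for the de Bruijn–Newman constant*, Res. Math. Sci. 6 (2019), Paper 31,
  arXiv:1904.12438: Prop. 6.3 (proof), §6.3 eq. (ec0-def), Prop. 6.6 (vi) and its proof, Thm. 1.3.
  [Polymath2019]
-/

noncomputable section

open Complex MeasureTheory Set Filter Topology

open scoped Real

namespace Literature.NumberTheory.LFunctions

namespace Polymath15

/-! ## E4a♯: the corrected majorant `ε̃♯` against `errC0` -/

section EpsSharpBounds

variable {t σ T : ℝ}

/-- `√(1/(1−δ)) ≤ e^{δ}` for `0 ≤ δ ≤ 1/2`. [folklore] -/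
private theorem sqrt_inv_le_exp {δ : ℝ} (h0 : 0 ≤ δ) (h1 : δ ≤ 1 / 2) :
    Real.sqrt (1 / (1 - δ)) ≤ Real.exp δ := by
  have hA : 0 < 1 - δ := by linarith
  have h2 : Real.sqrt (1 / (1 - δ)) ≤ 1 + δ := by
    rw [Real.sqrt_le_left (by linarith), div_le_iff₀ hA]
    nlinarith [sq_nonneg δ, mul_nonneg h0 (sq_nonneg δ)]
  exact h2.trans (by linarith [Real.add_one_le_exp δ])

/-- **The Gaussian factor is `e^{cσ + tc²/4}` up to `e^{O(κ)}`**: for `0 ≤ κ ≤ 1/368`, `0 ≤ t ≤ 1/2`,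
`0 ≤ σ ≤ 1`, `|c| ≤ 2.2`: `F(t,σ,κ,c) ≤ e^{cσ + tc²/4} e^{3.21κ}` (exactly:
`t(2κσ+c)²/(4(1−κt)) − tc²/4 = tκ(4κσ² + 4σc + tc²)/(4(1−κt))`). [cite: Polymath2019, Prop. 6.3, proof, (hit)–(hit2)] -/
theorem gaussF_le {κ c : ℝ} (hκ0 : 0 ≤ κ) (hκ : κ ≤ 1 / 368) (ht0 : 0 ≤ t) (ht : t ≤ 1 / 2)
    (hσ0 : 0 ≤ σ) (hσ1 : σ ≤ 1) (hc : |c| ≤ 2.2) :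
    gaussF t σ κ c ≤ Real.exp (c * σ + t * c ^ 2 / 4) * Real.exp (3.21 * κ) := by
  have hδ1 : κ * t ≤ 1 / 2 := by nlinarith
  have hδ0 : 0 ≤ κ * t := mul_nonneg hκ0 ht0
  have hA : 0 < 1 - κ * t := by linarith
  have h1 := sqrt_inv_le_exp hδ0 hδ1
  have hD : (4 * (1 - κ * t)) ≠ 0 := mul_ne_zero (by norm_num) hA.ne'
  have hX : t * (2 * κ * σ + c) ^ 2 / (4 * (1 - κ * t)) - t * c ^ 2 / 4 =
      t * κ * (4 * κ * σ ^ 2 + 4 * σ * c + t * c ^ 2) / (4 * (1 - κ * t)) := by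
    rw [eq_div_iff hD, sub_mul, div_mul_cancel₀ _ hD]
    ring
  have hc2 : c ^ 2 ≤ 4.84 := by
    have := abs_le.1 hc; nlinarith
  have hσc : σ * c ≤ 2.2 := by
    have := abs_le.1 hc; nlinarith
  have hX2 : t * κ * (4 * κ * σ ^ 2 + 4 * σ * c + t * c ^ 2) / (4 * (1 - κ * t)) ≤ 1.41 * κ := by
    rw [div_le_iff₀ (by positivity)]
    have hnum : 4 * κ * σ ^ 2 + 4 * σ * c + t * c ^ 2 ≤ 11.24 := by nlinarith
    have : t * κ * (4 * κ * σ ^ 2 + 4 * σ * c + t * c ^ 2) ≤ 1 / 2 * κ * 11.24 := by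
      have hk : 0 ≤ t * κ := by positivity
      calc t * κ * (4 * κ * σ ^ 2 + 4 * σ * c + t * c ^ 2) ≤ t * κ * 11.24 := by
            exact mul_le_mul_of_nonneg_left hnum hk
        _ ≤ 1 / 2 * κ * 11.24 := by nlinarith
    nlinarith
  rw [gaussF]
  calc Real.sqrt (1 / (1 - κ * t)) *
        Real.exp (κ * σ ^ 2 + c * σ + t * (2 * κ * σ + c) ^ 2 / (4 * (1 - κ * t)))
      ≤ Real.exp (κ * t) * Real.exp (c * σ + t * c ^ 2 / 4 + 2.71 * κ) := by
        have hσ2 : σ ^ 2 ≤ 1 := by nlinarith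
        have hκσ : κ * σ ^ 2 ≤ κ := by nlinarith [mul_le_mul_of_nonneg_left hσ2 hκ0]
        refine mul_le_mul h1 (Real.exp_le_exp.2 ?_) (by positivity) (by positivity)
        linarith [hX, hX2]
    _ = Real.exp (c * σ + t * c ^ 2 / 4) * Real.exp (2.71 * κ + κ * t) := by
        rw [← Real.exp_add, ← Real.exp_add]; ring_nf
    _ ≤ Real.exp (c * σ + t * c ^ 2 / 4) * Real.exp (3.21 * κ) := by
        gcongr; nlinarith

/-- **The `2^{−u}` family on `u < 0`**: `F(t,σ,κ,−log 2) τ♯(t,σ) ≤ e^{3.21κ} b♭(t,σ)` with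
`b♭ = ½ e^{−σ²/t}` if `σ ≥ (t/2)log 2` and `b♭ = e^{t log²2/4}` otherwise (`2^{−σ} ≤ 1`).
[cite: Polymath2019, Prop. 6.3, proof, δ₂] -/
def bFlat (t σ : ℝ) : ℝ :=
  if Real.log 2 * t / 2 ≤ σ then 1 / 2 * Real.exp (-σ ^ 2 / t) else Real.exp (t * Real.log 2 ^ 2 / 4)

/-- See `bFlat`. [cite: Polymath2019, Prop. 6.3, proof, δ₂] -/
theorem gaussF_tauS_le {κ : ℝ} (hκ0 : 0 ≤ κ) (hκ : κ ≤ 1 / 368) (ht0 : 0 < t) (ht : t ≤ 1 / 2)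
    (hσ0 : 0 ≤ σ) (hσ1 : σ ≤ 1) :
    gaussF t σ κ (-Real.log 2) * tauS t σ ≤ Real.exp (3.21 * κ) * bFlat t σ := by
  have hl2 := Real.log_two_lt_d9
  have hl2' := Real.log_two_gt_d9
  have hc : |(-Real.log 2)| ≤ 2.2 := by rw [abs_neg, abs_of_pos (by linarith)]; linarith
  by_cases hσ : Real.log 2 * t / 2 ≤ σ
  · rw [tauS, if_pos hσ, bFlat, if_pos hσ, gaussF]
    have hδ1 : κ * t ≤ 1 / 2 := by nlinarith
    have hδ0 : 0 ≤ κ * t := mul_nonneg hκ0 ht0.le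
    have hA : 0 < 1 - κ * t := by linarith
    have h1 := sqrt_inv_le_exp hδ0 hδ1
    have hD : (4 * (1 - κ * t)) ≠ 0 := mul_ne_zero (by norm_num) hA.ne'
    have hX : t * (2 * κ * σ + -Real.log 2) ^ 2 / (4 * (1 - κ * t)) - t * (-Real.log 2) ^ 2 / 4 =
        t * κ * (4 * κ * σ ^ 2 + 4 * σ * (-Real.log 2) + t * (-Real.log 2) ^ 2) / (4 * (1 - κ * t)) := by
      rw [eq_div_iff hD, sub_mul, div_mul_cancel₀ _ hD]
      ring
    have hX2 : t * κ * (4 * κ * σ ^ 2 + 4 * σ * (-Real.log 2) + t * (-Real.log 2) ^ 2) /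
        (4 * (1 - κ * t)) ≤ 0.04 * κ := by
      rw [div_le_iff₀ (by positivity)]
      have hnum : 4 * κ * σ ^ 2 + 4 * σ * (-Real.log 2) + t * (-Real.log 2) ^ 2 ≤ 0.26 := by
        nlinarith
      have hk : 0 ≤ t * κ := by positivity
      have : t * κ * (4 * κ * σ ^ 2 + 4 * σ * (-Real.log 2) + t * (-Real.log 2) ^ 2) ≤
          1 / 2 * κ * 0.26 := by
        calc _ ≤ t * κ * 0.26 := mul_le_mul_of_nonneg_left hnum hk
          _ ≤ 1 / 2 * κ * 0.26 := by nlinarith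
      nlinarith
    -- the exponent identity: `E − (σ − t log2/2)²/t = −σ²/t + κσ² + X`
    have hE : κ * σ ^ 2 + -Real.log 2 * σ + t * (2 * κ * σ + -Real.log 2) ^ 2 / (4 * (1 - κ * t)) +
        -(σ - Real.log 2 * t / 2) ^ 2 / t =
        -σ ^ 2 / t + κ * σ ^ 2 + (t * (2 * κ * σ + -Real.log 2) ^ 2 / (4 * (1 - κ * t)) -
          t * (-Real.log 2) ^ 2 / 4) := by
      field_simp
      ring
    calc Real.sqrt (1 / (1 - κ * t)) *
          Real.exp (κ * σ ^ 2 + -Real.log 2 * σ + t * (2 * κ * σ + -Real.log 2) ^ 2 / (4 * (1 - κ * t))) *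
          (1 / 2 * Real.exp (-(σ - Real.log 2 * t / 2) ^ 2 / t))
        = 1 / 2 * (Real.sqrt (1 / (1 - κ * t)) *
            Real.exp (κ * σ ^ 2 + -Real.log 2 * σ + t * (2 * κ * σ + -Real.log 2) ^ 2 / (4 * (1 - κ * t)) +
              -(σ - Real.log 2 * t / 2) ^ 2 / t)) := by
          rw [Real.exp_add (κ * σ ^ 2 + -Real.log 2 * σ +
            t * (2 * κ * σ + -Real.log 2) ^ 2 / (4 * (1 - κ * t))) (-(σ - Real.log 2 * t / 2) ^ 2 / t)]
          ring
      _ ≤ 1 / 2 * (Real.exp (κ * t) * Real.exp (-σ ^ 2 / t + 1.05 * κ)) := by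
          rw [hE]
          have hσ2 : σ ^ 2 ≤ 1 := by nlinarith
          have hκσ : κ * σ ^ 2 ≤ κ := by nlinarith [mul_le_mul_of_nonneg_left hσ2 hκ0]
          refine mul_le_mul_of_nonneg_left
            (mul_le_mul h1 (Real.exp_le_exp.2 ?_) (by positivity) (by positivity)) (by norm_num)
          linarith [hX, hX2]
      _ = 1 / 2 * Real.exp (-σ ^ 2 / t + (1.05 * κ + κ * t)) := by
          rw [← Real.exp_add]; congr 2; ring
      _ = Real.exp (1.05 * κ + κ * t) * (1 / 2 * Real.exp (-σ ^ 2 / t)) := by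
          rw [Real.exp_add]; ring
      _ ≤ Real.exp (3.21 * κ) * (1 / 2 * Real.exp (-σ ^ 2 / t)) := by
          gcongr; nlinarith
  · rw [tauS, if_neg hσ, bFlat, if_neg hσ, mul_one]
    refine (gaussF_le hκ0 hκ ht0.le ht hσ0 hσ1 hc).trans ?_
    rw [mul_comm]
    gcongr
    rw [neg_sq]
    have : -Real.log 2 * σ ≤ 0 := by nlinarith
    linarith

/-- `ω = 3.21κ + 0.63/T²`, the total `e^{O(1/T)}` correction. [cite: Polymath2019, Prop. 6.3] -/
def omegaS (T : ℝ) : ℝ := 3.21 * kapS T + 0.63 / T ^ 2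

/-- **The flattened majorant**: for `0 < t ≤ 1/2`, `0 ≤ σ ≤ 1`, `T ≥ 100`, `a = rsA t T`,
`ε̃♯ ≤ ½(e^{ω} − 1) + e^{ω}[0.1995·9^σ e^{t log²3}/a + 0.1729·2^{3σ/2} e^{t(3 log 2/2)²/4}/a²`
`  + (0.1775/a + 0.0445/a² + 0.0176/a³ + 0.07/a⁴) b♭(t,σ)] + 10⁻⁷/a`. [cite: Polymath2019, Prop. 6.3] -/
theorem epsSharp_le (ht0 : 0 < t) (ht : t ≤ 1 / 2) (hσ0 : 0 ≤ σ) (hσ1 : σ ≤ 1) (hT : 100 ≤ T) :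
    epsSharp t σ T ≤
      1 / 2 * (Real.exp (omegaS T) - 1) +
        Real.exp (omegaS T) *
          (0.1995 * ((9 : ℝ) ^ σ * Real.exp (t * Real.log 3 ^ 2)) / rsA t T +
            0.1729 * ((2 : ℝ) ^ (3 * σ / 2) * Real.exp (t * (3 / 2 * Real.log 2) ^ 2 / 4)) /
              rsA t T ^ 2 +
            (0.1775 / rsA t T + 0.0445 / rsA t T ^ 2 + 0.0176 / rsA t T ^ 3 + 0.07 / rsA t T ^ 4) *
              bFlat t σ) +
        1e-7 / rsA t T := by
  obtain ⟨hκ0, -, hA, -⟩ := kapS_bounds hT ht0.le ht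
  have hκ : kapS T ≤ 1 / 368 := by
    rw [kapS, div_le_div_iff₀ (by linarith) (by norm_num)]; linarith
  have ha : 3.98 ≤ rsA t T := rsA_ge' ht0.le hT
  have ha0 : 0 < rsA t T := by linarith
  set a := rsA t T
  set κ := kapS T
  set q₀ : ℝ := 0.63 / T ^ 2 with hq₀
  have hω : omegaS T = 3.21 * κ + q₀ := rfl
  have hl2 := Real.log_two_lt_d9
  have hl2' := Real.log_two_gt_d9
  have hl9 : Real.log 9 = 2 * Real.log 3 := by
    rw [show (9 : ℝ) = 3 ^ 2 by norm_num, Real.log_pow]; ring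
  have hl3 : Real.log 3 ≤ 1.0988 := by
    rw [Real.log_le_iff_le_exp (by norm_num)]
    refine le_trans ?_ (Real.sum_le_exp_of_nonneg (by norm_num) 8)
    simp only [Finset.sum_range_succ, Finset.sum_range_zero, Nat.factorial]
    norm_num
  have hl3' : 0 < Real.log 3 := Real.log_pos (by norm_num)
  -- the four Gaussian factors
  have F0 : gaussF t σ κ 0 ≤ Real.exp (3.21 * κ) := by
    have := gaussF_le (c := 0) hκ0 hκ ht0.le ht hσ0 hσ1 (by norm_num)
    simpa using this
  have F9 : gaussF t σ κ (Real.log 9) ≤ (9 : ℝ) ^ σ * Real.exp (t * Real.log 3 ^ 2) * Real.exp (3.21 * κ) := by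
    have := gaussF_le (c := Real.log 9) hκ0 hκ ht0.le ht hσ0 hσ1
      (by rw [abs_of_pos (by rw [hl9]; linarith), hl9]; linarith)
    refine this.trans (le_of_eq ?_)
    rw [Real.rpow_def_of_pos (by norm_num), ← Real.exp_add, ← Real.exp_add, ← Real.exp_add, hl9]
    ring_nf
  have F3 : gaussF t σ κ (3 / 2 * Real.log 2) ≤
      (2 : ℝ) ^ (3 * σ / 2) * Real.exp (t * (3 / 2 * Real.log 2) ^ 2 / 4) * Real.exp (3.21 * κ) := by
    have := gaussF_le (c := 3 / 2 * Real.log 2) hκ0 hκ ht0.le ht hσ0 hσ1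
      (by rw [abs_of_pos (by positivity)]; linarith)
    refine this.trans (le_of_eq ?_)
    rw [Real.rpow_def_of_pos (by norm_num), ← Real.exp_add, ← Real.exp_add, ← Real.exp_add]
    ring_nf
  have F2 := gaussF_tauS_le hκ0 hκ ht0 ht hσ0 hσ1
  have hq₀0 : 0 ≤ q₀ := by positivity
  have hωκ : Real.exp (3.21 * κ) ≤ Real.exp (omegaS T) := Real.exp_le_exp.2 (by rw [hω]; linarith)
  have heq : Real.exp q₀ * Real.exp (3.21 * κ) = Real.exp (omegaS T) := by
    rw [hω, ← Real.exp_add]; ring_nf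
  have hP : 0 ≤ 0.1775 / a + 0.0445 / a ^ 2 + 0.0176 / a ^ 3 + 0.07 / a ^ 4 := by positivity
  have hb : 0 ≤ bFlat t σ := by unfold bFlat; split_ifs <;> positivity
  rw [epsSharp]
  have e1 : Real.exp q₀ * (1 / 2 * gaussF t σ κ 0) ≤ 1 / 2 * Real.exp (omegaS T) := by
    rw [← heq]; nlinarith [Real.exp_pos q₀, F0]
  have e2 : Real.exp q₀ * (0.1995 * gaussF t σ κ (Real.log 9) / a) ≤
      Real.exp (omegaS T) * (0.1995 * ((9 : ℝ) ^ σ * Real.exp (t * Real.log 3 ^ 2)) / a) := by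
    rw [← heq]
    have := mul_le_mul_of_nonneg_left F9 (by positivity : (0 : ℝ) ≤ Real.exp q₀ * 0.1995 / a)
    calc Real.exp q₀ * (0.1995 * gaussF t σ κ (Real.log 9) / a)
        = Real.exp q₀ * 0.1995 / a * gaussF t σ κ (Real.log 9) := by ring
      _ ≤ Real.exp q₀ * 0.1995 / a * ((9 : ℝ) ^ σ * Real.exp (t * Real.log 3 ^ 2) * Real.exp (3.21 * κ)) := this
      _ = _ := by ring
  have e3 : Real.exp q₀ * (0.1729 * gaussF t σ κ (3 / 2 * Real.log 2) / a ^ 2) ≤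
      Real.exp (omegaS T) *
        (0.1729 * ((2 : ℝ) ^ (3 * σ / 2) * Real.exp (t * (3 / 2 * Real.log 2) ^ 2 / 4)) / a ^ 2) := by
    rw [← heq]
    have := mul_le_mul_of_nonneg_left F3 (by positivity : (0 : ℝ) ≤ Real.exp q₀ * 0.1729 / a ^ 2)
    calc Real.exp q₀ * (0.1729 * gaussF t σ κ (3 / 2 * Real.log 2) / a ^ 2)
        = Real.exp q₀ * 0.1729 / a ^ 2 * gaussF t σ κ (3 / 2 * Real.log 2) := by ring
      _ ≤ Real.exp q₀ * 0.1729 / a ^ 2 * ((2 : ℝ) ^ (3 * σ / 2) *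
          Real.exp (t * (3 / 2 * Real.log 2) ^ 2 / 4) * Real.exp (3.21 * κ)) := this
      _ = _ := by ring
  have e4 : Real.exp q₀ * ((0.1775 / a + 0.0445 / a ^ 2 + 0.0176 / a ^ 3 + 0.07 / a ^ 4) *
      gaussF t σ κ (-Real.log 2) * tauS t σ) ≤
      Real.exp (omegaS T) * ((0.1775 / a + 0.0445 / a ^ 2 + 0.0176 / a ^ 3 + 0.07 / a ^ 4) *
        bFlat t σ) := by
    rw [← heq]
    have := mul_le_mul_of_nonneg_left F2 (by positivity :
      (0 : ℝ) ≤ Real.exp q₀ * (0.1775 / a + 0.0445 / a ^ 2 + 0.0176 / a ^ 3 + 0.07 / a ^ 4))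
    calc Real.exp q₀ * ((0.1775 / a + 0.0445 / a ^ 2 + 0.0176 / a ^ 3 + 0.07 / a ^ 4) *
          gaussF t σ κ (-Real.log 2) * tauS t σ)
        = Real.exp q₀ * (0.1775 / a + 0.0445 / a ^ 2 + 0.0176 / a ^ 3 + 0.07 / a ^ 4) *
            (gaussF t σ κ (-Real.log 2) * tauS t σ) := by ring
      _ ≤ Real.exp q₀ * (0.1775 / a + 0.0445 / a ^ 2 + 0.0176 / a ^ 3 + 0.07 / a ^ 4) *
            (Real.exp (3.21 * κ) * bFlat t σ) := this
      _ = _ := by ring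
  have hsum : Real.exp q₀ * (1 / 2 * gaussF t σ κ 0 + 0.1995 * gaussF t σ κ (Real.log 9) / a +
      0.1729 * gaussF t σ κ (3 / 2 * Real.log 2) / a ^ 2 +
      (0.1775 / a + 0.0445 / a ^ 2 + 0.0176 / a ^ 3 + 0.07 / a ^ 4) * gaussF t σ κ (-Real.log 2) *
        tauS t σ) =
      Real.exp q₀ * (1 / 2 * gaussF t σ κ 0) + Real.exp q₀ * (0.1995 * gaussF t σ κ (Real.log 9) / a) +
      Real.exp q₀ * (0.1729 * gaussF t σ κ (3 / 2 * Real.log 2) / a ^ 2) +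
      Real.exp q₀ * ((0.1775 / a + 0.0445 / a ^ 2 + 0.0176 / a ^ 3 + 0.07 / a ^ 4) *
        gaussF t σ κ (-Real.log 2) * tauS t σ) := by ring
  rw [hsum]
  linarith

end EpsSharpBounds

/-! ## E4a♯: `e^{c_Q}(1 + ε̃♯(s₋) + ε̃♯(s₊)) ≤ exp(1.24(3^y+3^{−y})/(N−0.125) + (3|L+iπ/2|+10.44)/(x−12))` -/

section EC0Sharp

variable {t x y : ℝ}

/-- `κ(x/2) = 1/(2x − 32)` and `ω(x/2) ≤ 0.0088`, `e^{ω} ≤ 1.0089` for `x ≥ 200`. [cite: Polymath2019, Prop. 6.3] -/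
private theorem omega_bounds (hx : 200 ≤ x) :
    kapS (x / 2) ≤ 1 / 368 ∧ 0 ≤ omegaS (x / 2) ∧ omegaS (x / 2) ≤ 0.0088 ∧
      Real.exp (omegaS (x / 2)) ≤ 1.0089 ∧
      omegaS (x / 2) ≤ 1.7446 / x + 0.0126 / x := by
  have hx0 : 0 < x := by linarith
  have hk : kapS (x / 2) = 1 / (2 * x - 32) := by rw [kapS]; ring
  have hk1 : kapS (x / 2) ≤ 1 / 368 := by
    rw [hk, div_le_div_iff₀ (by linarith) (by norm_num)]; linarith
  have hk0 : 0 ≤ kapS (x / 2) := by rw [hk]; exact div_nonneg zero_le_one (by linarith)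
  have hq : 0.63 / (x / 2) ^ 2 = 2.52 / x ^ 2 := by field_simp; ring
  have hq1 : 2.52 / x ^ 2 ≤ 0.0126 / x := by
    rw [div_le_div_iff₀ (by positivity) hx0]; nlinarith
  have hq2 : 2.52 / x ^ 2 ≤ 0.000063 := by
    rw [div_le_iff₀ (by positivity)]; nlinarith
  have hk2 : kapS (x / 2) ≤ 1.7446 / (3.21 * x) := by
    rw [hk, div_le_div_iff₀ (by linarith) (by positivity)]; nlinarith
  have hω0 : 0 ≤ omegaS (x / 2) := by rw [omegaS, hq]; positivity
  have hω1 : omegaS (x / 2) ≤ 0.0088 := by rw [omegaS, hq]; linarith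
  refine ⟨hk1, hω0, hω1, ?_, ?_⟩
  · have h := Real.abs_exp_sub_one_sub_id_le (x := omegaS (x / 2))
      (by rw [abs_of_nonneg hω0]; linarith)
    have h2 := (abs_le.1 h).2
    nlinarith
  · rw [omegaS, hq]
    have : 3.21 * (1.7446 / (3.21 * x)) = 1.7446 / x := by field_simp
    linarith [mul_le_mul_of_nonneg_left hk2 (by norm_num : (0:ℝ) ≤ 3.21)]

/-- `log 3 ≤ 1.0988` and `e^{t log² 3} ≤ 1.83` for `0 ≤ t ≤ 1/2`. [folklore] -/
private theorem exp_t_log_three_sq_le (ht : t ≤ 1 / 2) :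
    Real.exp (t * Real.log 3 ^ 2) ≤ 1.83 := by
  have hl3 : Real.log 3 ≤ 1.0988 := by
    rw [Real.log_le_iff_le_exp (by norm_num)]
    refine le_trans ?_ (Real.sum_le_exp_of_nonneg (by norm_num) 8)
    simp only [Finset.sum_range_succ, Finset.sum_range_zero, Nat.factorial]
    norm_num
  have hl3' : 0 < Real.log 3 := Real.log_pos (by norm_num)
  have h1 : t * Real.log 3 ^ 2 ≤ 0.6037 := by nlinarith
  refine (Real.exp_le_exp.2 h1).trans ?_
  have := Real.exp_bound' (x := 0.6037) (by norm_num) (by norm_num) (n := 5) (by norm_num)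
  refine this.trans ?_
  simp only [Finset.sum_range_succ, Finset.sum_range_zero, Nat.factorial]
  norm_num

/-- `e^{t(3 log 2/2)²/4} ≤ 1.1535` and `e^{t log²2/4} ≤ 1.0638` for `0 ≤ t ≤ 1/2`. [folklore] -/
private theorem exp_t_log_two_le (ht : t ≤ 1 / 2) :
    Real.exp (t * (3 / 2 * Real.log 2) ^ 2 / 4) ≤ 1.1535 ∧
      Real.exp (t * Real.log 2 ^ 2 / 4) ≤ 1.0638 := by
  have hl := Real.log_two_lt_d9
  have hl' := Real.log_two_gt_d9
  constructor
  · have h1 : t * (3 / 2 * Real.log 2) ^ 2 / 4 ≤ 0.1352 := by nlinarith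
    refine (Real.exp_le_exp.2 h1).trans ?_
    have h := Real.abs_exp_sub_one_sub_id_le (x := 0.1352) (by rw [abs_le]; constructor <;> norm_num)
    have := (abs_le.1 h).2
    linarith
  · have h1 : t * Real.log 2 ^ 2 / 4 ≤ 0.0601 := by nlinarith
    refine (Real.exp_le_exp.2 h1).trans ?_
    have h := Real.abs_exp_sub_one_sub_id_le (x := 0.0601) (by rw [abs_le]; constructor <;> norm_num)
    have := (abs_le.1 h).2
    linarith

/-- `9^{(1−y)/2} + 9^{(1+y)/2} = 3(3^y + 3^{−y})`. [folklore] -/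
private theorem nine_rpow_sum (y : ℝ) :
    (9 : ℝ) ^ ((1 - y) / 2) + (9 : ℝ) ^ ((1 + y) / 2) = 3 * ((3 : ℝ) ^ y + (3 : ℝ) ^ (-y)) := by
  have h9 : (9 : ℝ) = (3 : ℝ) ^ (2 : ℝ) := by norm_num
  rw [h9, ← Real.rpow_mul (by norm_num), ← Real.rpow_mul (by norm_num),
    show (2 : ℝ) * ((1 - y) / 2) = 1 + -y by ring, show (2 : ℝ) * ((1 + y) / 2) = 1 + y by ring,
    Real.rpow_add (by norm_num), Real.rpow_add (by norm_num), Real.rpow_one]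
  ring

/-- `2^{3σ₋/2} + 2^{3σ₊/2} ≤ 3.8285` for `σ_∓ = (1∓y)/2`, `0 ≤ y ≤ 1` (`u + 2^{3/2}/u` on `[1, 2^{3/4}]`).
[folklore] -/
private theorem two_rpow_sum_le (hy0 : 0 ≤ y) (hy1 : y ≤ 1) :
    (2 : ℝ) ^ (3 * ((1 - y) / 2) / 2) + (2 : ℝ) ^ (3 * ((1 + y) / 2) / 2) ≤ 3.8285 := by
  set u : ℝ := (2 : ℝ) ^ (3 * ((1 - y) / 2) / 2) with hu
  have hu0 : 0 < u := Real.rpow_pos_of_pos (by norm_num) _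
  have hu1 : 1 ≤ u := Real.one_le_rpow (by norm_num) (by nlinarith)
  have hprod : u * (2 : ℝ) ^ (3 * ((1 + y) / 2) / 2) = (2 : ℝ) ^ (3 / 2 : ℝ) := by
    rw [hu, ← Real.rpow_add (by norm_num)]; ring_nf
  have h32 : (2 : ℝ) ^ (3 / 2 : ℝ) ≤ 2.8285 := by
    have : (2 : ℝ) ^ (3 / 2 : ℝ) = Real.sqrt 8 := by
      rw [show (3 / 2 : ℝ) = (3 : ℕ) * (1 / 2 : ℝ) by norm_num, Real.rpow_mul (by norm_num),
        Real.sqrt_eq_rpow]; norm_num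
    rw [this, Real.sqrt_le_left (by norm_num)]; norm_num
  have h32' : 1 ≤ (2 : ℝ) ^ (3 / 2 : ℝ) := Real.one_le_rpow (by norm_num) (by norm_num)
  have hv : (2 : ℝ) ^ (3 * ((1 + y) / 2) / 2) = (2 : ℝ) ^ (3 / 2 : ℝ) / u := by
    rw [← hprod]; field_simp
  rw [hv]
  have hule : u ≤ (2 : ℝ) ^ (3 / 2 : ℝ) := by
    rw [← hprod]
    exact le_mul_of_one_le_right hu0.le (Real.one_le_rpow (by norm_num) (by nlinarith))
  rw [div_eq_mul_inv]
  have key : u + (2 : ℝ) ^ (3 / 2 : ℝ) * u⁻¹ ≤ 1 + (2 : ℝ) ^ (3 / 2 : ℝ) := by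
    have hinv : u⁻¹ = 1 / u := (one_div u).symm
    rw [hinv, ← sub_nonneg]
    have : 1 + (2 : ℝ) ^ (3 / 2 : ℝ) - (u + (2 : ℝ) ^ (3 / 2 : ℝ) * (1 / u)) =
        (u - 1) * ((2 : ℝ) ^ (3 / 2 : ℝ) - u) / u := by field_simp; ring
    rw [this]
    exact div_nonneg (mul_nonneg (by linarith) (by linarith)) hu0.le
  linarith

/-- `b♭(t, (1−y)/2) ≤ 1.0638` and `b♭(t, (1+y)/2) ≤ 0.3077` (`0 < t ≤ 1/2`, `0 ≤ y ≤ 1`). [folklore] -/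
private theorem bFlat_bounds (ht0 : 0 < t) (ht : t ≤ 1 / 2) (hy0 : 0 ≤ y) :
    bFlat t ((1 - y) / 2) ≤ 1.0638 ∧ bFlat t ((1 + y) / 2) ≤ 0.3077 := by
  obtain ⟨-, h2⟩ := exp_t_log_two_le ht
  have hl := Real.log_two_lt_d9
  constructor
  · unfold bFlat
    split_ifs
    · have : Real.exp (-((1 - y) / 2) ^ 2 / t) ≤ 1 := by
        rw [Real.exp_le_one_iff, neg_div]; exact neg_nonpos.2 (by positivity)
      linarith
    · exact h2
  · unfold bFlat
    have hσ : Real.log 2 * t / 2 ≤ (1 + y) / 2 := by nlinarith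
    rw [if_pos hσ]
    have h1 : -((1 + y) / 2) ^ 2 / t ≤ -(1 / 2) := by
      rw [neg_div, neg_le_neg_iff, le_div_iff₀ ht0]; nlinarith
    have h3 : Real.exp (-(1 / 2 : ℝ)) ≤ 0.6154 := by
      rw [Real.exp_neg, inv_le_comm₀ (Real.exp_pos _) (by norm_num)]
      refine le_trans ?_ (Real.sum_le_exp_of_nonneg (by norm_num) 4)
      simp only [Finset.sum_range_succ, Finset.sum_range_zero, Nat.factorial]
      norm_num
    have := (Real.exp_le_exp.2 h1).trans h3
    linarith

/-- `3^y + 3^{−y} ≥ 2`. [folklore] -/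
private theorem three_rpow_add_ge (y : ℝ) : 2 ≤ (3 : ℝ) ^ y + (3 : ℝ) ^ (-y) := by
  have h0 : 0 < (3 : ℝ) ^ y := Real.rpow_pos_of_pos (by norm_num) _
  have h1 : (3 : ℝ) ^ (-y) = ((3 : ℝ) ^ y)⁻¹ := Real.rpow_neg (by norm_num) y
  rw [h1, ← sub_nonneg]
  have : (3 : ℝ) ^ y + ((3 : ℝ) ^ y)⁻¹ - 2 = ((3 : ℝ) ^ y - 1) ^ 2 / (3 : ℝ) ^ y := by
    field_simp; ring
  rw [this]; positivity

/-- `log(x/4π) ≥ 2.7` for `x ≥ 200`. [folklore] -/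
private theorem log_x_div_four_pi_ge (hx : 200 ≤ x) : 2.7 ≤ Real.log (x / (4 * π)) := by
  have hπ := Real.pi_lt_d2
  rw [Real.le_log_iff_exp_le (by positivity)]
  have h1 : Real.exp 2.7 ≤ 14.9 := by
    rw [show (2.7 : ℝ) = 1 + 1 + 0.7 by norm_num, Real.exp_add, Real.exp_add]
    have he := Real.exp_one_lt_d9
    have h7 := Real.exp_bound' (x := 0.7) (by norm_num) (by norm_num) (n := 5) (by norm_num)
    have h7' : Real.exp 0.7 ≤ 2.014 := by
      refine h7.trans ?_
      simp only [Finset.sum_range_succ, Finset.sum_range_zero, Nat.factorial]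
      norm_num
    have he0 := Real.exp_pos (1 : ℝ)
    have h70 := Real.exp_pos (0.7 : ℝ)
    nlinarith [mul_pos he0 he0]
  refine h1.trans ?_
  rw [le_div_iff₀ (by positivity)]; nlinarith

/-- The inverse powers of `a = √(x/4π + t/16)` against `1/x`: `1/a² ≤ 4π/x ≤ 12.567/x`,
`1/a³ ≤ 3.158/x`, `1/a⁴ ≤ 0.79/x` (`x ≥ 200`, `t ≥ 0`). [cite: Polymath2019, Prop. 6.6 (vi), proof] -/
private theorem inv_rsA_pow_le (ht0 : 0 ≤ t) (hx : 200 ≤ x) :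
    1 / rsA t (x / 2) ^ 2 ≤ 12.567 / x ∧ 1 / rsA t (x / 2) ^ 3 ≤ 3.158 / x ∧
      1 / rsA t (x / 2) ^ 4 ≤ 0.79 / x := by
  have hπ := Real.pi_lt_d6
  have hx0 : 0 < x := by linarith
  have ha := rsA_ge ht0 hx
  have ha0 : 0 < rsA t (x / 2) := by linarith
  have hsq : rsA t (x / 2) ^ 2 = x / (4 * π) + t / 16 := by
    rw [rsA_half, Real.sq_sqrt (by positivity)]
  have h2 : 1 / rsA t (x / 2) ^ 2 ≤ 12.567 / x := by
    rw [hsq, div_le_div_iff₀ (by positivity) hx0]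
    have : x ≤ 12.567 * (x / (4 * π)) := by
      rw [mul_div_assoc', le_div_iff₀ (by positivity)]; nlinarith
    nlinarith
  have h1a : 1 / rsA t (x / 2) ≤ 1 / 3.98 := one_div_le_one_div_of_le (by norm_num) ha
  have e3 : 1 / rsA t (x / 2) ^ 3 = 1 / rsA t (x / 2) ^ 2 * (1 / rsA t (x / 2)) := by
    rw [one_div_mul_one_div, ← pow_succ]
  have e4 : 1 / rsA t (x / 2) ^ 4 = 1 / rsA t (x / 2) ^ 2 * (1 / rsA t (x / 2) ^ 2) := by
    rw [one_div_mul_one_div, ← pow_add]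
  refine ⟨h2, ?_, ?_⟩
  · rw [e3]
    calc 1 / rsA t (x / 2) ^ 2 * (1 / rsA t (x / 2)) ≤ 12.567 / x * (1 / 3.98) :=
          mul_le_mul h2 h1a (by positivity) (by positivity)
      _ ≤ 3.158 / x := by
          rw [div_mul_div_comm, div_le_div_iff₀ (by positivity) hx0]; nlinarith
  · rw [e4]
    calc 1 / rsA t (x / 2) ^ 2 * (1 / rsA t (x / 2) ^ 2) ≤ 12.567 / x * (12.567 / x) :=
          mul_le_mul h2 h2 (by positivity) (by positivity)
      _ ≤ 0.79 / x := by
          rw [div_mul_div_comm, div_le_div_iff₀ (mul_pos hx0 hx0) hx0]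
          have h1 : (157.93 : ℝ) ≤ 0.79 * x := by linarith
          calc (12.567 : ℝ) * 12.567 * x ≤ 157.93 * x := by
                apply mul_le_mul_of_nonneg_right _ hx0.le; norm_num
            _ ≤ 0.79 * x * x := mul_le_mul_of_nonneg_right h1 hx0.le
            _ = 0.79 * (x * x) := by ring

/-- (I), the `1/a` budget: `e^ω(0.1995·E₃(9^{σ₋}+9^{σ₊}) + 0.1775(b♭₋+b♭₊)) + 2·10⁻⁷ ≤ 1.24(3^y+3^{−y})`
(all quantities abstracted to real variables with their bounds). [cite: Polymath2019, Prop. 6.6 (vi), proof] -/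
private theorem budget_I {S eω E3 Nm Np bm bp : ℝ} (hS : 2 ≤ S) (heω : eω ≤ 1.0089)
    (hE3 : E3 ≤ 1.83) (hE30 : 0 < E3) (hNm0 : 0 ≤ Nm) (hNp0 : 0 ≤ Np) (h9 : Nm + Np = 3 * S)
    (hbm : bm ≤ 1.0638) (hbp : bp ≤ 0.3077) (hbm0 : 0 ≤ bm) (hbp0 : 0 ≤ bp) :
    (eω * (0.1995 * (Nm * E3) + 0.1775 * bm) + 1e-7) +
      (eω * (0.1995 * (Np * E3) + 0.1775 * bp) + 1e-7) ≤ 1.24 * S := by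
  have hmain9 : 0.1995 * (Nm * E3) + 0.1995 * (Np * E3) ≤ 1.09527 * S := by
    have e : 0.1995 * (Nm * E3) + 0.1995 * (Np * E3) = 0.1995 * E3 * (3 * S) := by rw [← h9]; ring
    rw [e]
    have hS0 : 0 ≤ 3 * S := by linarith
    nlinarith [mul_le_mul_of_nonneg_right hE3 hS0]
  have h1 : 0.1995 * (Nm * E3) + 0.1775 * bm + (0.1995 * (Np * E3) + 0.1775 * bp) ≤
      1.09527 * S + 0.24345 := by linarith
  have hA0 : 0 ≤ 0.1995 * (Nm * E3) := by positivity
  have hB0 : 0 ≤ 0.1995 * (Np * E3) := by positivity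
  have hX0 : 0 ≤ 0.1995 * (Nm * E3) + 0.1775 * bm + (0.1995 * (Np * E3) + 0.1775 * bp) := by
    linarith
  have h2 := mul_le_mul heω h1 hX0 (by norm_num)
  have e : (eω * (0.1995 * (Nm * E3) + 0.1775 * bm) + 1e-7) +
      (eω * (0.1995 * (Np * E3) + 0.1775 * bp) + 1e-7) =
      eω * (0.1995 * (Nm * E3) + 0.1775 * bm + (0.1995 * (Np * E3) + 0.1775 * bp)) + 2e-7 := by
    ring
  rw [e]
  linarith

/-- (II), the `1/x` budget: `c_Q + (e^ω − 1) + e^ω(RS family + tails) ≤ (3L + 10.44)/x`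
(abstracted). [cite: Polymath2019, Prop. 6.6 (vi), proof] -/
private theorem budget_II {L a eω E2 Tm Tp bm bp : ℝ} (hx : 200 ≤ x) (hL : 2.7 ≤ L)
    (heω : eω ≤ 1.0089) (hex : eω - 1 ≤ 1.7748 / x) (ha0 : 0 < a)
    (hia2 : 1 / a ^ 2 ≤ 12.567 / x) (hia3 : 1 / a ^ 3 ≤ 3.158 / x) (hia4 : 1 / a ^ 4 ≤ 0.79 / x)
    (hE2 : E2 ≤ 1.1535) (hE20 : 0 < E2) (hTm0 : 0 ≤ Tm) (hTp0 : 0 ≤ Tp) (h2 : Tm + Tp ≤ 3.8285)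
    (hbm : bm ≤ 1.0638) (hbp : bp ≤ 0.3077) (hbm0 : 0 ≤ bm) (hbp0 : 0 ≤ bp) :
    L / (2 * x ^ 2) + 3.58 / (x - 6) + (eω - 1) +
      (eω * (0.1729 * (Tm * E2) / a ^ 2 + (0.0445 / a ^ 2 + 0.0176 / a ^ 3 + 0.07 / a ^ 4) * bm) +
        eω * (0.1729 * (Tp * E2) / a ^ 2 + (0.0445 / a ^ 2 + 0.0176 / a ^ 3 + 0.07 / a ^ 4) * bp))
      ≤ (3 * L + 10.44) / x := by
  have hx0 : 0 < x := by linarith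
  have hcQ1 : 3.58 / (x - 6) ≤ 3.691 / x := by
    rw [div_le_div_iff₀ (by linarith) hx0]; nlinarith
  have hcQ2 : L / (2 * x ^ 2) ≤ 0.0025 * L / x := by
    rw [div_le_div_iff₀ (by positivity) hx0]
    have hL0 : 0 ≤ L := by linarith
    nlinarith [mul_nonneg hL0 hx0.le, mul_nonneg (mul_nonneg hL0 hx0.le) (by linarith : (0:ℝ) ≤ x - 200)]
  have hrs : 0.1729 * (Tm * E2) / a ^ 2 + 0.1729 * (Tp * E2) / a ^ 2 ≤ 9.6 / x := by
    have e1 : 0.1729 * (Tm * E2) / a ^ 2 + 0.1729 * (Tp * E2) / a ^ 2 =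
        0.1729 * E2 * (Tm + Tp) * (1 / a ^ 2) := by ring
    rw [e1]
    calc 0.1729 * E2 * (Tm + Tp) * (1 / a ^ 2) ≤ 0.1729 * 1.1535 * 3.8285 * (12.567 / x) := by
          gcongr
      _ ≤ 9.6 / x := by
          rw [← mul_div_assoc, div_le_div_iff₀ hx0 hx0]; nlinarith
  have hq : 0.0445 / a ^ 2 + 0.0176 / a ^ 3 + 0.07 / a ^ 4 ≤ 0.6702 / x := by
    have e : 0.0445 / a ^ 2 + 0.0176 / a ^ 3 + 0.07 / a ^ 4 =
        0.0445 * (1 / a ^ 2) + 0.0176 * (1 / a ^ 3) + 0.07 * (1 / a ^ 4) := by ring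
    rw [e]
    have : 0.0445 * (12.567 / x) + 0.0176 * (3.158 / x) + 0.07 * (0.79 / x) ≤ 0.6702 / x := by
      rw [show 0.0445 * (12.567 / x) + 0.0176 * (3.158 / x) + 0.07 * (0.79 / x) =
        (0.0445 * 12.567 + 0.0176 * 3.158 + 0.07 * 0.79) / x by ring]
      exact div_le_div_of_nonneg_right (by norm_num) hx0.le
    nlinarith [hia2, hia3, hia4]
  have hq0 : 0 ≤ 0.0445 / a ^ 2 + 0.0176 / a ^ 3 + 0.07 / a ^ 4 := by positivity
  have hneg : (0.0445 / a ^ 2 + 0.0176 / a ^ 3 + 0.07 / a ^ 4) * bm +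
      (0.0445 / a ^ 2 + 0.0176 / a ^ 3 + 0.07 / a ^ 4) * bp ≤ 0.92 / x := by
    rw [← mul_add]
    calc (0.0445 / a ^ 2 + 0.0176 / a ^ 3 + 0.07 / a ^ 4) * (bm + bp)
        ≤ 0.6702 / x * (1.0638 + 0.3077) :=
          mul_le_mul hq (by linarith) (by linarith) (by positivity)
      _ ≤ 0.92 / x := by
          rw [div_mul_eq_mul_div, div_le_div_iff₀ hx0 hx0]; nlinarith
  have hin : 0 ≤ 0.1729 * (Tm * E2) / a ^ 2 + (0.0445 / a ^ 2 + 0.0176 / a ^ 3 + 0.07 / a ^ 4) * bm +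
      (0.1729 * (Tp * E2) / a ^ 2 + (0.0445 / a ^ 2 + 0.0176 / a ^ 3 + 0.07 / a ^ 4) * bp) := by
    have q1 : 0 ≤ 0.1729 * (Tm * E2) / a ^ 2 := by positivity
    have q2 : 0 ≤ 0.1729 * (Tp * E2) / a ^ 2 := by positivity
    nlinarith [mul_nonneg hq0 hbm0, mul_nonneg hq0 hbp0]
  rw [← mul_add]
  have hprod : eω * (0.1729 * (Tm * E2) / a ^ 2 +
      (0.0445 / a ^ 2 + 0.0176 / a ^ 3 + 0.07 / a ^ 4) * bm +
      (0.1729 * (Tp * E2) / a ^ 2 + (0.0445 / a ^ 2 + 0.0176 / a ^ 3 + 0.07 / a ^ 4) * bp))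
      ≤ 1.0089 * (9.6 / x + 0.92 / x) :=
    mul_le_mul heω (by linarith) hin (by norm_num)
  have hfin : 0.0025 * L / x + 3.691 / x + 1.7748 / x + 1.0089 * (9.6 / x + 0.92 / x) ≤
      (3 * L + 10.44) / x := by
    rw [show 0.0025 * L / x + 3.691 / x + 1.7748 / x + 1.0089 * (9.6 / x + 0.92 / x) =
      (0.0025 * L + 3.691 + 1.7748 + 1.0089 * (9.6 + 0.92)) / x by ring]
    exact div_le_div_of_nonneg_right (by linarith only [hL]) hx0.le
  linarith only [hcQ1, hcQ2, hex, hprod, hfin]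

/-- **E4a♯, the analytic core**: in the region (1.6), with `L = log(x/4π)`, `a = √(x/4π + t/16)`,
`c_Q + ε̃♯(s₋) + ε̃♯(s₊) ≤ 1.24(3^y+3^{−y})/a + (3L + 10.44)/x`, where
`c_Q = L/(2x²) + 3.58/(x−6)`. [cite: Polymath2019, Prop. 6.6 (vi), proof] -/
theorem cQ_add_epsSharp_le (h : EffRegion t x y) :
    Real.log (x / (4 * π)) / (2 * x ^ 2) + 3.58 / (x - 6) +
        epsSharp t ((1 - y) / 2) (x / 2) + epsSharp t ((1 + y) / 2) (x / 2) ≤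
      1.24 * ((3 : ℝ) ^ y + (3 : ℝ) ^ (-y)) / rsA t (x / 2) +
        (3 * Real.log (x / (4 * π)) + 10.44) / x := by
  obtain ⟨ht, ht', hy0, hy1, hx⟩ := h
  have hx0 : 0 < x := by linarith
  have hT : 100 ≤ x / 2 := by linarith
  obtain ⟨-, hω0, hω1, heω, hωx⟩ := omega_bounds hx
  have ha := rsA_ge ht.le hx
  have ha0 : 0 < rsA t (x / 2) := by linarith
  have hL := log_x_div_four_pi_ge hx
  have hS := three_rpow_add_ge y
  obtain ⟨hia2, hia3, hia4⟩ := inv_rsA_pow_le ht.le hx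
  obtain ⟨hbm, hbp⟩ := bFlat_bounds ht ht' hy0
  have hbm0 : 0 ≤ bFlat t ((1 - y) / 2) := by unfold bFlat; split_ifs <;> positivity
  have hbp0 : 0 ≤ bFlat t ((1 + y) / 2) := by unfold bFlat; split_ifs <;> positivity
  have hE3 := exp_t_log_three_sq_le ht'
  obtain ⟨hE2a, -⟩ := exp_t_log_two_le ht'
  have h9 := nine_rpow_sum y
  have h2 := two_rpow_sum_le hy0 hy1
  have hex : Real.exp (omegaS (x / 2)) - 1 ≤ 1.7748 / x := by
    have h := Real.abs_exp_sub_one_sub_id_le (x := omegaS (x / 2))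
      (by rw [abs_of_nonneg hω0]; linarith)
    have h2 := (abs_le.1 h).2
    have : omegaS (x / 2) ^ 2 ≤ 0.0088 * omegaS (x / 2) := by nlinarith
    have h3 : Real.exp (omegaS (x / 2)) - 1 ≤ 1.0088 * omegaS (x / 2) := by nlinarith
    have h4 : 1.0088 * omegaS (x / 2) ≤ 1.0088 * (1.7446 / x + 0.0126 / x) := by nlinarith
    have h5 : 1.0088 * (1.7446 / x + 0.0126 / x) ≤ 1.7748 / x := by
      rw [← add_div, ← mul_div_assoc, div_le_div_iff₀ hx0 hx0]; nlinarith
    linarith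
  have hI := budget_I hS heω hE3 (Real.exp_pos _) (Real.rpow_nonneg (by norm_num) _)
    (Real.rpow_nonneg (by norm_num) _) h9 hbm hbp hbm0 hbp0
  have hII := budget_II hx hL heω hex ha0 hia2 hia3 hia4 hE2a (Real.exp_pos _)
    (Real.rpow_nonneg (by norm_num) _) (Real.rpow_nonneg (by norm_num) _) h2 hbm hbp hbm0 hbp0
  have hIa := div_le_div_of_nonneg_right hI ha0.le
  rw [add_div] at hIa
  -- the flattened majorants at `σ₋ = (1−y)/2` and `σ₊ = (1+y)/2`, split into `1/a` and `1/x` parts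
  have hsplit : ∀ σ : ℝ,
      1 / 2 * (Real.exp (omegaS (x / 2)) - 1) +
        Real.exp (omegaS (x / 2)) * (0.1995 * ((9 : ℝ) ^ σ * Real.exp (t * Real.log 3 ^ 2)) / rsA t (x / 2) +
          0.1729 * ((2 : ℝ) ^ (3 * σ / 2) * Real.exp (t * (3 / 2 * Real.log 2) ^ 2 / 4)) /
            rsA t (x / 2) ^ 2 +
          (0.1775 / rsA t (x / 2) + 0.0445 / rsA t (x / 2) ^ 2 + 0.0176 / rsA t (x / 2) ^ 3 +
            0.07 / rsA t (x / 2) ^ 4) * bFlat t σ) + 1e-7 / rsA t (x / 2) =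
      1 / 2 * (Real.exp (omegaS (x / 2)) - 1) +
        (Real.exp (omegaS (x / 2)) * (0.1995 * ((9 : ℝ) ^ σ * Real.exp (t * Real.log 3 ^ 2)) +
          0.1775 * bFlat t σ) + 1e-7) / rsA t (x / 2) +
        Real.exp (omegaS (x / 2)) *
          (0.1729 * ((2 : ℝ) ^ (3 * σ / 2) * Real.exp (t * (3 / 2 * Real.log 2) ^ 2 / 4)) /
            rsA t (x / 2) ^ 2 +
          (0.0445 / rsA t (x / 2) ^ 2 + 0.0176 / rsA t (x / 2) ^ 3 + 0.07 / rsA t (x / 2) ^ 4) *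
            bFlat t σ) := by
    intro σ
    have ha0' : rsA t (x / 2) ≠ 0 := ha0.ne'
    field_simp
    ring
  have hm := epsSharp_le (σ := (1 - y) / 2) ht ht' (by linarith only [hy1]) (by linarith only [hy0]) hT
  have hp := epsSharp_le (σ := (1 + y) / 2) ht ht' (by linarith only [hy0]) (by linarith only [hy1]) hT
  rw [hsplit] at hm hp
  linarith only [hIa, hII, hm, hp]

/-- **E4a♯**: `e^{c_Q}(1 + ε̃♯(s₋) + ε̃♯(s₊)) ≤ exp(1.24(3^y+3^{−y})/(N−0.125) + (3|L+iπ/2|+10.44)/(x−12))`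
in the region (1.6) (`1 + u ≤ e^u`, `N ≤ a`, `L ≤ |L + iπ/2|`, `1/x ≤ 1/(x−12)`).
[cite: Polymath2019, Prop. 6.6 (vi) and Thm. 1.3] -/
theorem exp_mul_one_add_epsSharp_le (h : EffRegion t x y) :
    Real.exp (Real.log (x / (4 * π)) / (2 * x ^ 2) + 3.58 / (x - 6)) *
        (1 + epsSharp t ((1 - y) / 2) (x / 2) + epsSharp t ((1 + y) / 2) (x / 2)) ≤
      Real.exp (1.24 * ((3 : ℝ) ^ y + (3 : ℝ) ^ (-y)) / ((rsN t x : ℝ) - 0.125) +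
        (3 * ‖(Real.log (x / (4 * π)) : ℂ) + π / 2 * I‖ + 10.44) / (x - 12)) := by
  have hcore := cQ_add_epsSharp_le h
  obtain ⟨ht, ht', hy0, hy1, hx⟩ := h
  have hx0 : 0 < x := by linarith
  set L := Real.log (x / (4 * π)) with hLdef
  set S := (3 : ℝ) ^ y + (3 : ℝ) ^ (-y) with hSdef
  have hS : 0 ≤ S := by have := three_rpow_add_ge y; rw [← hSdef] at this; linarith
  have ha := rsA_ge ht.le hx
  have hN3 := three_le_rsN ht.le hx
  have hNa := rsN_le_rsA t x
  have hL0 : 0 ≤ L := by have := log_x_div_four_pi_ge hx; rw [← hLdef] at this; linarith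
  -- `1 + u ≤ e^u`
  have h1 : 1 + epsSharp t ((1 - y) / 2) (x / 2) + epsSharp t ((1 + y) / 2) (x / 2) ≤
      Real.exp (epsSharp t ((1 - y) / 2) (x / 2) + epsSharp t ((1 + y) / 2) (x / 2)) := by
    have := Real.add_one_le_exp (epsSharp t ((1 - y) / 2) (x / 2) + epsSharp t ((1 + y) / 2) (x / 2))
    linarith
  -- weaken the right-hand side
  have hR1 : 1.24 * S / rsA t (x / 2) ≤ 1.24 * S / ((rsN t x : ℝ) - 0.125) :=
    div_le_div_of_nonneg_left (by positivity) (by linarith) (by linarith)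
  have hR2 : (3 * L + 10.44) / x ≤ (3 * ‖(L : ℂ) + π / 2 * I‖ + 10.44) / (x - 12) := by
    have hLn : L ≤ ‖(L : ℂ) + π / 2 * I‖ := by
      have := Complex.abs_re_le_norm ((L : ℂ) + π / 2 * I)
      simp at this
      rwa [abs_of_nonneg hL0] at this
    calc (3 * L + 10.44) / x ≤ (3 * ‖(L : ℂ) + π / 2 * I‖ + 10.44) / x := by gcongr
      _ ≤ (3 * ‖(L : ℂ) + π / 2 * I‖ + 10.44) / (x - 12) :=
          div_le_div_of_nonneg_left (by positivity) (by linarith) (by linarith)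
  rcases le_or_gt (1 + epsSharp t ((1 - y) / 2) (x / 2) + epsSharp t ((1 + y) / 2) (x / 2)) 0 with hn | hp'
  · exact (mul_nonpos_of_nonneg_of_nonpos (Real.exp_pos _).le hn).trans (Real.exp_pos _).le
  · calc Real.exp (L / (2 * x ^ 2) + 3.58 / (x - 6)) *
          (1 + epsSharp t ((1 - y) / 2) (x / 2) + epsSharp t ((1 + y) / 2) (x / 2))
        ≤ Real.exp (L / (2 * x ^ 2) + 3.58 / (x - 6)) *
            Real.exp (epsSharp t ((1 - y) / 2) (x / 2) + epsSharp t ((1 + y) / 2) (x / 2)) :=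
          mul_le_mul_of_nonneg_left h1 (Real.exp_pos _).le
      _ = Real.exp (L / (2 * x ^ 2) + 3.58 / (x - 6) +
            (epsSharp t ((1 - y) / 2) (x / 2) + epsSharp t ((1 + y) / 2) (x / 2))) :=
          (Real.exp_add _ _).symm
      _ ≤ _ := Real.exp_le_exp.2 (by linarith)

/-- The corrected `e_{C,0}`: `e^{tπ²/64}|M₀(iT')|(1 + ε̃♯(s₋) + ε̃♯(s₊))/|B_t|`.
[cite: Polymath2019, §6.3 eq. (ec0-def)] -/
def eC0Sharp (t x y : ℝ) : ℝ :=
  Real.exp (t * π ^ 2 / 64) * ‖M₀ (I * (x / 2 + π * t / 8 : ℝ))‖ / ‖Bt t x y‖ *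
    (1 + epsSharp t ((1 - y) / 2) (x / 2) + epsSharp t ((1 + y) / 2) (x / 2))

/-- **E4a♯**: in the region (1.6), `e♯_{C,0} ≤ errC0` (the printed majorant of Thm. 1.3, via
`Q_le` of E4a and `exp_mul_one_add_epsSharp_le`). [cite: Polymath2019, Prop. 6.6 (vi) and Thm. 1.3] -/
theorem eC0Sharp_le_errC0 (h : EffRegion t x y) : eC0Sharp t x y ≤ errC0 t x y := by
  have hQ := Q_le h
  have hF := exp_mul_one_add_epsSharp_le h
  obtain ⟨ht, ht', hy0, hy1, hx⟩ := h
  set L : ℝ := Real.log (x / (4 * π)) with hL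
  set c : ℝ := L / (2 * x ^ 2) + 3.58 / (x - 6) with hc
  set u : ℝ := 1.24 * ((3 : ℝ) ^ y + (3 : ℝ) ^ (-y)) / ((rsN t x : ℝ) - 0.125) with hu
  set w : ℝ := (3 * ‖(L : ℂ) + π / 2 * I‖ + 10.44) / (x - 12) with hw
  set E : ℝ := 1 + epsSharp t ((1 - y) / 2) (x / 2) + epsSharp t ((1 + y) / 2) (x / 2) with hEdef
  set P : ℝ := (x / (4 * π)) ^ (-(1 + y) / 4) with hP
  have hP0 : 0 ≤ P := Real.rpow_nonneg (by positivity) _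
  rw [eC0Sharp, errC0]
  rcases le_or_gt E 0 with hE | hE
  · calc Real.exp (t * π ^ 2 / 64) * ‖M₀ (I * (x / 2 + π * t / 8 : ℝ))‖ / ‖Bt t x y‖ * E ≤ 0 :=
          mul_nonpos_of_nonneg_of_nonpos (by positivity) hE
      _ ≤ _ := by positivity
  · calc Real.exp (t * π ^ 2 / 64) * ‖M₀ (I * (x / 2 + π * t / 8 : ℝ))‖ / ‖Bt t x y‖ * E
        ≤ P * Real.exp (-(t / 16) * L ^ 2 + L / (2 * x ^ 2) + 3.58 / (x - 6)) * E :=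
          mul_le_mul_of_nonneg_right hQ hE.le
      _ = P * Real.exp (-(t / 16) * L ^ 2) * (Real.exp c * E) := by
          rw [show -(t / 16) * L ^ 2 + L / (2 * x ^ 2) + 3.58 / (x - 6) = -(t / 16) * L ^ 2 + c by
            rw [hc]; ring, Real.exp_add]
          ring
      _ ≤ P * Real.exp (-(t / 16) * L ^ 2) * Real.exp (u + w) :=
          mul_le_mul_of_nonneg_left hF (by positivity)
      _ = P * Real.exp (-(t / 16) * L ^ 2 + u + w) := by
          rw [add_assoc, Real.exp_add (-(t / 16) * L ^ 2)]
          ring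

end EC0Sharp

end Polymath15

end Literature.NumberTheory.LFunctions

end
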